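import Summits.FinalStateConjecture.FinalStateConjecture.Theorems.EIHFluxBalanceInertialRecessionRechartSpinZero2
import Summits.FinalStateConjecture.FinalStateConjecture.Theorems.EIHFluxBalanceInertialRecessionRechartWhiteHoleExclusion
import Summits.FinalStateConjecture.FinalStateConjecture.Theorems.EIHFluxBalanceInertialRecessionStubPaintedVelocityKinematics

/-!
# Route EIHFluxBalance — `InertialRecession`: the `a = 0` RE-CHARTING THEOREM from lab-time
# causality and velocity convergence only

Helper file for the crux `stmt-FinalStateConjecture-10166`
(`Summit.FinalStateConjecture.FinalStateConjecture.Theses.EIHFluxBalance.InertialRecession`),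
stub `stub_rechart` (the transfer P2 of line `sublinear-is-free-clean-window-charges`).

`inertialRecession_spinZero_of_labTime''`: antecedent (verbatim) + (aᵢ = 0) + Slaved³ (verbatim) +
VELOCITY CONVERGENCE + Cesàro (verbatim) + eventual LAB-TIME CAUSALITY (the registered hypothesis of
`stub_rechart`, verbatim) ⇒ the crux conclusion (verbatim). The orthochronicity clause (O) of
`inertialRecession_spinZero_of_labTime` is DISCHARGED: a hole whose painted frame is
anti-orthochronous would be a painted WHITE hole, excluded by `false_of_antiOrthochronous_hole`
(`…RechartWhiteHoleExclusion`: escape curve + Cauchy-surface bookkeeping + the horizon lemma F1);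
orthochronicity at one time propagates to all times (`lorentz_apply_zero_pos_of_exists`); the
sign-blind speed bound is the landed `norm_labVelocity_le_sqrt_max` (line `old-light-leaves-the-cone`).
Compared with `stub_rechart` the ONLY extra hypotheses are (aᵢ = 0) and velocity convergence;
`inertialRecession_spinZero_of_paintedVelocity` takes instead the convergence of the PAINTED lab
velocities, which the line's landed endgame (`exists_tendsto_velocity_of_dichotomy`) provides.
[folklore]
-/

noncomputable section

set_option linter.dupNamespace false

open scoped Topology ContDiff InnerProductSpace Manifold ENNReal BigOperators
open Filter Set Metric Topology Function TopologicalSpace Literature.Geometry.Lorentzian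

namespace Summit.FinalStateConjecture.FinalStateConjecture.Theorems

/-! ### A sign-free speed bound (from the landed `…StubPaintedVelocityKinematics`) -/

/-- Registered one-line form (stub `norm_labVelocity_lt_one_rechart` of the crux item): the lab
speed of any Lorentz frame is `< 1`. [folklore] -/
theorem norm_labVelocity_lt_one_rechart : open Literature.Geometry.Lorentzian in ∀ (Λ : lorentzGroup), ‖((((Λ : E4 ≃L[ℝ] E4) (E4.basisVector 0)) 0)⁻¹ • E4.spatial ((Λ : E4 ≃L[ℝ] E4) (E4.basisVector 0)))‖ < 1 :=
  fun Λ ↦ (norm_labVelocity_le_sqrt_max Λ le_rfl).trans_lt (sqrt_one_sub_inv_max_sq_lt_one _).2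

/-! ### The re-charting theorem without the orientation clause -/

-- long statement and bookkeeping proof
set_option maxHeartbeats 1600000 in
/-- **The `a = 0` RE-CHARTING THEOREM from lab-time causality and velocity convergence.** See the
module docstring. [folklore] -/
theorem inertialRecession_spinZero_of_labTime'' : ∀ (X : Type) [TopologicalSpace X] [ChartedSpace E3 X] [IsManifold (𝓡 3) ((⊤ : ℕ∞) : WithTop ℕ∞) X] [T2Space X] [SecondCountableTopology X] [ConnectedSpace X], ∀ D ∈ admissibleVacuumData X, ∀ 𝒟 : VacuumCauchyDevelopment D, 𝒟.IsMaximal → ∀ (N : ℕ) (M a rin : Fin N → ℝ) (Λ : Fin N → ℝ → lorentzGroup) (ξ : Fin N → ℝ → E3) (γ κ τ₀ : ℝ) (U : Opens E4) (Φ : U → 𝒟.carrier) (O : Set 𝒟.carrier), ((∀ i, Kerr.IsSubextremal (M i) (a i) ∧ Kerr.rMinus (M i) (a i) < rin i ∧ rin i < Kerr.rPlus (M i) (a i)) ∧ (∀ i t, |((Λ i t : E4 ≃L[ℝ] E4) (E4.basisVector 0)) 0| ≤ γ) ∧ (∀ i, ContDiff ℝ ((⊤ : ℕ∞) : WithTop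 ℕ∞) (ξ i) ∧ ContDiff ℝ ((⊤ : ℕ∞) : WithTop ℕ∞) (fun t ↦ ((Λ i t : E4 ≃L[ℝ] E4) : E4 →L[ℝ] E4))) ∧ (∀ i j, i ≠ j → Tendsto (fun t ↦ ‖ξ i t - ξ j t‖) atTop atTop) ∧ (0 < κ ∧ κ < 1 ∧ ∀ i, ∀ᶠ t in atTop, ‖ξ i t‖ ≤ κ ^ 2 * t) ∧ ({x : E4 | τ₀ < x 0 ∧ ∀ i, rin i < Kerr.radius (a i) (poincareInv (Λ i (x 0)) (E4.ofTimeSpace (x 0) (ξ i (x 0))) x)} ⊆ (U : Set E4)) ∧ let B : ModelBackground := ⟨U, fun x ↦ Minkowski.bilin + ∑ i, (boostedKerrBilin (Λ i (x 0)) (E4.ofTimeSpace (x 0) (ξ i (x 0))) (M i) (a i) x - Minkowski.bilin), fun x ↦ x 0, E4.spatialNorm⟩; ContMDiff 𝓘(ℝ, E4) (𝓡 4) ((⊤ : ℕ∞) : WithTop ℕ∞) Φ ∧ Topology.IsOpenEmbedding ((B.lateRegion τ₀).restrict Φ) ∧ Φ '' {x : U | τ₀ < x.1 0 ∧ ∀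 i, Kerr.rPlus (M i) (a i) < Kerr.radius (a i) (poincareInv (Λ i (x.1 0)) (E4.ofTimeSpace (x.1 0) (ξ i (x.1 0))) x.1)} ⊆ O ∧ Tendsto (fun t ↦ 𝒟.toSpacetime.deviationCk B Φ 3 t) atTop (𝓝 0) ∧ Tendsto (fun t : ℝ ↦ ⨆ x ∈ {x : U | x.1 0 = t ∧ E4.spatialNorm x.1 ≤ κ * t}, ⨆ (m : ℕ) (_ : m ≤ 3), ENNReal.ofReal (1 + √(√((⨅ i, ‖E4.spatial x.1 - ξ i t‖) ^ 7))) * ‖iteratedFDeriv ℝ m (𝒟.toSpacetime.deviationExtend B Φ) x.1‖ₑ) atTop (𝓝 0) ∧ O = Summit.FinalStateConjecture.exteriorOf 𝒟.toCauchyDevelopment (Φ '' {x : U | τ₀ < x.1 0 ∧ ∀ i, Kerr.rPlus (M i) (a i) < Kerr.radius (a i) (poincareInv (Λ i (x.1 0)) (E4.ofTimeSpace (x.1 0) (ξ i (x.1 0))) x.1)}) ∧ ∀ t₁ : ℝ, τ₀ < t₁ → O \ Φ '' {x : U | t₁ < x.1 0 ∧ ∀ i, Kerr.rPlus (M i) (a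 i) < Kerr.radius (a i) (poincareInv (Λ i (x.1 0)) (E4.ofTimeSpace (x.1 0) (ξ i (x.1 0))) x.1)} ⊆ 𝒟.metric.causalPast 𝒟.timeOrientation (Φ '' {x : U | x.1 0 = t₁ ∧ ∀ i, Kerr.rPlus (M i) (a i) < Kerr.radius (a i) (poincareInv (Λ i (x.1 0)) (E4.ofTimeSpace (x.1 0) (ξ i (x.1 0))) x.1)})) →
    (∀ i : Fin N, a i = 0) →
    (∀ i : Fin N, (∀ m : ℕ, 1 ≤ m → m ≤ 3 → Tendsto (fun t ↦ iteratedDeriv m (fun s ↦ (((Λ i s : lorentzGroup) : E4 ≃L[ℝ] E4) (E4.basisVector 0))) t) atTop (𝓝 0)) ∧ (∀ m : ℕ, m ≤ 2 → Tendsto (fun t ↦ iteratedDeriv m (fun s ↦ deriv (ξ i) s - (((((Λ i s : lorentzGroup) : E4 ≃L[ℝ] E4) (E4.basisVector 0)) 0)⁻¹ • E4.spatial (((Λ i s : lorentzGroup) : E4 ≃L[ℝ] E4) (E4.basisVector 0)))) t) atTop (𝓝 0)) ∧ (a i ≠ 0 → ∀ m : ℕ, 1 ≤ m → m ≤ 3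 → Tendsto (fun t ↦ iteratedDeriv m (fun s ↦ (((Λ i s : lorentzGroup) : E4 ≃L[ℝ] E4) (E4.basisVector 3))) t) atTop (𝓝 0))) →
    (∀ i : Fin N, ∃ V : E3, Tendsto (deriv (ξ i)) atTop (𝓝 V)) →
    (∀ i : Fin N, ∃ V : E3, Tendsto (fun t : ℝ ↦ t⁻¹ • ξ i t) atTop (𝓝 V)) →
    (∃ τ₁ : ℝ, ∀ x y : U, (τ₁ < x.1 0 ∧ ∀ i, rin i < Kerr.radius (a i) (poincareInv (Λ i (x.1 0)) (E4.ofTimeSpace (x.1 0) (ξ i (x.1 0))) x.1)) → (τ₁ < y.1 0 ∧ ∀ i, rin i < Kerr.radius (a i) (poincareInv (Λ i (y.1 0)) (E4.ofTimeSpace (y.1 0) (ξ i (y.1 0))) y.1)) → Φ y ∈ 𝒟.metric.causalFuture 𝒟.timeOrientation {Φ x} → x.1 0 ≤ y.1 0) →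
    ∃ (O : Set 𝒟.carrier) (d : FinalStateDecomposition 𝒟.toSpacetime O 2), (∀ i, Kerr.IsSubextremal (d.mass i) (d.spin i)) ∧ O = Summit.FinalStateConjecture.exteriorOf 𝒟.toCauchyDevelopment d.charted ∧ Summit.FinalStateConjecture.HasExhaustiveCharts d := by
  intro X _ _ _ _ _ _ D hD 𝒟 h𝒟 N M a rin Λ ξ γ κ τ₀ U Φ O hL ha hS hVel hCes hT
  -- (Ofut) from lab-time causality
  obtain ⟨τ₁T, hT₁⟩ := hT
  have hsm := hL.2.2.1
  have hU : {x : E4 | τ₀ < x 0 ∧ ∀ i, rin i < Kerr.radius (a i) (poincareInv (Λ i (x 0))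
      (E4.ofTimeSpace (x 0) (ξ i (x 0))) x)} ⊆ (U : Set E4) := hL.2.2.2.2.2.1
  have hΦ : ContMDiff 𝓘(ℝ, E4) (𝓡 4) ∞ Φ := hL.2.2.2.2.2.2.1
  have hOfut : ∀ x : U, max τ₀ τ₁T < x.1 0 → (∀ j, rin j < Kerr.radius (a j)
      (poincareInv (Λ j (x.1 0)) (E4.ofTimeSpace (x.1 0) (ξ j (x.1 0))) x.1)) → ∀ w : E4, 0 < w 0 →
      𝒟.metric.val (Φ x) (mfderiv 𝓘(ℝ, E4) (𝓡 4) Φ x w) (mfderiv 𝓘(ℝ, E4) (𝓡 4) Φ x w) < 0 →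
        𝒟.timeOrientation.IsFutureDirected (mfderiv 𝓘(ℝ, E4) (𝓡 4) Φ x w) := by
    intro x hx hrad w hw htl
    have hopen := isOpen_setOf_lt_radius_poincareInv a rin Λ ξ (max τ₀ τ₁T)
      (fun i ↦ (hsm i).2.continuous) (fun i ↦ (hsm i).1.continuous)
    exact isFutureDirected_mfderiv_of_labTimeCausality hΦ hopen
      (fun z hz ↦ hU ⟨(le_max_left _ _).trans_lt hz.1, hz.2⟩)
      (fun x' y' hx' hy' hJ ↦ hT₁ x' y' ⟨(le_max_right _ _).trans_lt hx'.1, hx'.2⟩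
        ⟨(le_max_right _ _).trans_lt hy'.1, hy'.2⟩ hJ) x ⟨hx, hrad⟩ hw htl
  -- (O): every painted frame is orthochronous — else a painted white hole
  have hOrth : ∀ (i : Fin N) (t : ℝ), 0 < (((Λ i t : lorentzGroup) : E4 ≃L[ℝ] E4) (E4.basisVector 0)) 0 := by
    intro i
    by_cases hex : ∃ t, 0 < (((Λ i t : lorentzGroup) : E4 ≃L[ℝ] E4) (E4.basisVector 0)) 0
    · exact lorentz_apply_zero_pos_of_exists (hsm i).2.continuous hex
    · exfalso
      have hneg : ∀ t, (((Λ i t : lorentzGroup) : E4 ≃L[ℝ] E4) (E4.basisVector 0)) 0 < 0 := by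
        intro t
        have hle : (((Λ i t : lorentzGroup) : E4 ≃L[ℝ] E4) (E4.basisVector 0)) 0 ≤ 0 :=
          not_lt.mp fun h ↦ hex ⟨t, h⟩
        have h1 := one_le_abs_lorentz_apply_zero (Λ i t)
        rcases hle.lt_or_eq with h | h
        · exact h
        · rw [h, abs_zero] at h1; linarith
      -- the data of hole `i` (spins are zero)
      have ha' : a = fun _ ↦ 0 := funext ha
      subst ha'
      obtain ⟨hsub, hγb, -, hsep, -, -, hB⟩ := hL
      obtain ⟨-, hemb, himO, hdev, -, hO, hexh⟩ := hB
      beta_reduce at hsub hU hemb himO hdev hO hexh hOfut hT₁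
      have hM : ∀ j, 0 < M j := fun j ↦ (abs_nonneg (0 : ℝ)).trans_lt (hsub j).1
      have hrin : ∀ j, rin j < Kerr.rPlus (M j) 0 := fun j ↦ (hsub j).2.2
      obtain ⟨V, hξV⟩ := hVel i
      have hmis : Tendsto (fun t ↦ deriv (ξ i) t - ((((Λ i t : lorentzGroup) : E4 ≃L[ℝ] E4)
          (E4.basisVector 0)) 0)⁻¹ • E4.spatial (((Λ i t : lorentzGroup) : E4 ≃L[ℝ] E4)
            (E4.basisVector 0))) atTop (𝓝 0) := by
        simpa using (hS i).2.1 0 (Nat.zero_le 2)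
      have hv : Tendsto (fun t ↦ ((((Λ i t : lorentzGroup) : E4 ≃L[ℝ] E4) (E4.basisVector 0)) 0)⁻¹ •
          E4.spatial (((Λ i t : lorentzGroup) : E4 ≃L[ℝ] E4) (E4.basisVector 0))) atTop (𝓝 V) := by
        have h := hξV.sub hmis
        rw [sub_zero] at h
        exact h.congr fun t ↦ by simp
      have hV1 : ‖V‖ < 1 :=
        (le_of_tendsto' hv.norm fun t ↦ norm_labVelocity_le_sqrt_max (Λ i t) (hγb i t)).trans_lt
          (sqrt_one_sub_inv_max_sq_lt_one γ).2
      have hembΦ : IsOpenEmbedding (({x : U | τ₀ < x.1 0} : Set U).restrict Φ) := hemb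
      exact false_of_antiOrthochronous_hole 𝒟 i M rin Λ ξ hM hrin hγb (fun j ↦ (hsm j).2.continuous)
        (fun j ↦ (hsm j).1.continuous) ((hsm i).1.differentiable (by simp)) hV1 hξV hneg hv
        (fun j hj ↦ hsep i j (Ne.symm hj)) U Φ hΦ hU hembΦ hdev O hO himO hexh
        (fun x y hx hy hJ ↦ hT₁ x y hx hy hJ) hOfut
  exact inertialRecession_spinZero_of_labTime X D hD 𝒟 h𝒟 N M a rin Λ ξ γ κ τ₀ U Φ O hL ha hS hVel
    hCes hOrth ⟨τ₁T, hT₁⟩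

/-! ### The re-charting theorem from the landed endgame output -/

-- long statement
set_option maxHeartbeats 800000 in
/-- **The `a = 0` RE-CHARTING THEOREM from convergence of the PAINTED lab velocities.** Same as
`inertialRecession_spinZero_of_labTime''` with velocity convergence of the centres and the Cesàro
clause replaced by convergence of the painted lab velocities `vᵢ(t) = (Λᵢ(t)e₀)~/(Λᵢ(t)e₀)⁰ → Vᵢ` —
which is exactly the conclusion of the LANDED endgame of the line
(`SublinearIsFree.Endgame.exists_tendsto_velocity_of_dichotomy`); with the slaving clause of Slaved³
(`ξ̇ᵢ − vᵢ → 0`) it gives `ξ̇ᵢ → Vᵢ`, and the Cesàro clause follows (`cesaro_of_tendsto_deriv_rechart`).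
So, for `a ≡ 0`, `stub_rechart` is closed from the line's own landed material plus lab-time
causality. [folklore] -/
theorem inertialRecession_spinZero_of_paintedVelocity : ∀ (X : Type) [TopologicalSpace X] [ChartedSpace E3 X] [IsManifold (𝓡 3) ((⊤ : ℕ∞) : WithTop ℕ∞) X] [T2Space X] [SecondCountableTopology X] [ConnectedSpace X], ∀ D ∈ admissibleVacuumData X, ∀ 𝒟 : VacuumCauchyDevelopment D, 𝒟.IsMaximal → ∀ (N : ℕ) (M a rin : Fin N → ℝ) (Λ : Fin N → ℝ → lorentzGroup) (ξ : Fin N → ℝ → E3) (γ κ τ₀ : ℝ) (U : Opens E4) (Φ : U → 𝒟.carrier) (O : Set 𝒟.carrier), ((∀ i, Kerr.IsSubextremal (M i) (a i) ∧ Kerr.rMinus (M i) (a i) < rin i ∧ rin i < Kerr.rPlus (M i) (a i)) ∧ (∀ i t, |((Λ i t : E4 ≃L[ℝ] E4) (E4.basisVector 0)) 0| ≤ γ) ∧ (∀ i, ContDiff ℝ ((⊤ : ℕ∞) : WithTop ℕ∞) (ξ i) ∧ ContDiff ℝ ((⊤ : ℕ∞) : WithTop ℕ∞) (fun t ↦ ((Λ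 i t : E4 ≃L[ℝ] E4) : E4 →L[ℝ] E4))) ∧ (∀ i j, i ≠ j → Tendsto (fun t ↦ ‖ξ i t - ξ j t‖) atTop atTop) ∧ (0 < κ ∧ κ < 1 ∧ ∀ i, ∀ᶠ t in atTop, ‖ξ i t‖ ≤ κ ^ 2 * t) ∧ ({x : E4 | τ₀ < x 0 ∧ ∀ i, rin i < Kerr.radius (a i) (poincareInv (Λ i (x 0)) (E4.ofTimeSpace (x 0) (ξ i (x 0))) x)} ⊆ (U : Set E4)) ∧ let B : ModelBackground := ⟨U, fun x ↦ Minkowski.bilin + ∑ i, (boostedKerrBilin (Λ i (x 0)) (E4.ofTimeSpace (x 0) (ξ i (x 0))) (M i) (a i) x - Minkowski.bilin), fun x ↦ x 0, E4.spatialNorm⟩; ContMDiff 𝓘(ℝ, E4) (𝓡 4) ((⊤ : ℕ∞) : WithTop ℕ∞) Φ ∧ Topology.IsOpenEmbedding ((B.lateRegion τ₀).restrict Φ) ∧ Φ '' {x : U | τ₀ < x.1 0 ∧ ∀ i, Kerr.rPlus (M i) (a i) < Kerr.radius (a i) (poincareInv (Λ i (x.1 0)) (E4.ofTimeSpace (x.1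 0) (ξ i (x.1 0))) x.1)} ⊆ O ∧ Tendsto (fun t ↦ 𝒟.toSpacetime.deviationCk B Φ 3 t) atTop (𝓝 0) ∧ Tendsto (fun t : ℝ ↦ ⨆ x ∈ {x : U | x.1 0 = t ∧ E4.spatialNorm x.1 ≤ κ * t}, ⨆ (m : ℕ) (_ : m ≤ 3), ENNReal.ofReal (1 + √(√((⨅ i, ‖E4.spatial x.1 - ξ i t‖) ^ 7))) * ‖iteratedFDeriv ℝ m (𝒟.toSpacetime.deviationExtend B Φ) x.1‖ₑ) atTop (𝓝 0) ∧ O = Summit.FinalStateConjecture.exteriorOf 𝒟.toCauchyDevelopment (Φ '' {x : U | τ₀ < x.1 0 ∧ ∀ i, Kerr.rPlus (M i) (a i) < Kerr.radius (a i) (poincareInv (Λ i (x.1 0)) (E4.ofTimeSpace (x.1 0) (ξ i (x.1 0))) x.1)}) ∧ ∀ t₁ : ℝ, τ₀ < t₁ → O \ Φ '' {x : U | t₁ < x.1 0 ∧ ∀ i, Kerr.rPlus (M i) (a i) < Kerr.radius (a i) (poincareInv (Λ i (x.1 0)) (E4.ofTimeSpace (x.1 0) (ξ i (x.1 0))) x.1)}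 ⊆ 𝒟.metric.causalPast 𝒟.timeOrientation (Φ '' {x : U | x.1 0 = t₁ ∧ ∀ i, Kerr.rPlus (M i) (a i) < Kerr.radius (a i) (poincareInv (Λ i (x.1 0)) (E4.ofTimeSpace (x.1 0) (ξ i (x.1 0))) x.1)})) →
    (∀ i : Fin N, a i = 0) →
    (∀ i : Fin N, (∀ m : ℕ, 1 ≤ m → m ≤ 3 → Tendsto (fun t ↦ iteratedDeriv m (fun s ↦ (((Λ i s : lorentzGroup) : E4 ≃L[ℝ] E4) (E4.basisVector 0))) t) atTop (𝓝 0)) ∧ (∀ m : ℕ, m ≤ 2 → Tendsto (fun t ↦ iteratedDeriv m (fun s ↦ deriv (ξ i) s - (((((Λ i s : lorentzGroup) : E4 ≃L[ℝ] E4) (E4.basisVector 0)) 0)⁻¹ • E4.spatial (((Λ i s : lorentzGroup) : E4 ≃L[ℝ] E4) (E4.basisVector 0)))) t) atTop (𝓝 0)) ∧ (a i ≠ 0 → ∀ m : ℕ, 1 ≤ m → m ≤ 3 → Tendsto (fun t ↦ iteratedDeriv m (fun s ↦ (((Λ i s : lorentzGroup) : E4 ≃L[ℝ] E4) (E4.basisVector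 3))) t) atTop (𝓝 0))) →
    (∀ i : Fin N, ∃ V : E3, Tendsto (fun t ↦ ((((Λ i t : lorentzGroup) : E4 ≃L[ℝ] E4) (E4.basisVector 0)) 0)⁻¹ • E4.spatial (((Λ i t : lorentzGroup) : E4 ≃L[ℝ] E4) (E4.basisVector 0))) atTop (𝓝 V)) →
    (∃ τ₁ : ℝ, ∀ x y : U, (τ₁ < x.1 0 ∧ ∀ i, rin i < Kerr.radius (a i) (poincareInv (Λ i (x.1 0)) (E4.ofTimeSpace (x.1 0) (ξ i (x.1 0))) x.1)) → (τ₁ < y.1 0 ∧ ∀ i, rin i < Kerr.radius (a i) (poincareInv (Λ i (y.1 0)) (E4.ofTimeSpace (y.1 0) (ξ i (y.1 0))) y.1)) → Φ y ∈ 𝒟.metric.causalFuture 𝒟.timeOrientation {Φ x} → x.1 0 ≤ y.1 0) →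
    ∃ (O : Set 𝒟.carrier) (d : FinalStateDecomposition 𝒟.toSpacetime O 2), (∀ i, Kerr.IsSubextremal (d.mass i) (d.spin i)) ∧ O = Summit.FinalStateConjecture.exteriorOf 𝒟.toCauchyDevelopment d.charted ∧ Summit.FinalStateConjecture.HasExhaustiveCharts d := by
  intro X _ _ _ _ _ _ D hD 𝒟 h𝒟 N M a rin Λ ξ γ κ τ₀ U Φ O hL ha hS hv hT
  have hVel : ∀ i : Fin N, ∃ V : E3, Tendsto (deriv (ξ i)) atTop (𝓝 V) := by
    intro i
    obtain ⟨V, hV⟩ := hv i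
    refine ⟨V, ?_⟩
    have hmis : Tendsto (fun t ↦ deriv (ξ i) t - ((((Λ i t : lorentzGroup) : E4 ≃L[ℝ] E4)
        (E4.basisVector 0)) 0)⁻¹ • E4.spatial (((Λ i t : lorentzGroup) : E4 ≃L[ℝ] E4)
          (E4.basisVector 0))) atTop (𝓝 0) := by
      simpa using (hS i).2.1 0 (Nat.zero_le 2)
    have h := hmis.add hV
    rw [zero_add] at h
    exact h.congr fun t ↦ by simp
  have hCes : ∀ i : Fin N, ∃ V : E3, Tendsto (fun t : ℝ ↦ t⁻¹ • ξ i t) atTop (𝓝 V) := fun i ↦ by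
    obtain ⟨V, hV⟩ := hVel i
    exact ⟨V, cesaro_of_tendsto_deriv_rechart ((hL.2.2.1 i).1.differentiable (by simp)) hV⟩
  exact inertialRecession_spinZero_of_labTime'' X D hD 𝒟 h𝒟 N M a rin Λ ξ γ κ τ₀ U Φ O hL ha hS hVel
    hCes hT

end Summit.FinalStateConjecture.FinalStateConjecture.Theorems
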